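import Summits.Ventures.YMGap.Thresholds.TwistedBochnerSUN
import Summits.Ventures.YMGap.Thresholds.OneLinkEigenCalculus
import Summits.QuantumFields.BalabanUV.InfraRed.StrongCouplingPoincareDoorSUN
import HarnessLib

/-!
# Venture YMGap — SU(3) TWISTED BOCHNER: a hypothesis-free one-link Poincaré constant beyond Bakry–Émery,
# `K₃ = 12/7 − (32/35)·|c|‖B‖_F/√6` (`≈ 1.714 − 1.940 R` on `‖B‖_op ≤ R` for the one-link law, against `3(1/2 − R)`)

HONEST FRAMING.  Venture file of the cell `pub-ymgap` (QuantumFields programme), seat engine-2 (g11); 0 compute.  Explicit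
STRONG-COUPLING constants for ONE tilted Haar law `ν_B(dg) ∝ exp(3 Re tr(gB)) dg` on `SU(3)` (small-`β` bookkeeping for lattice
Yang–Mills); NOT weak coupling, NOT a continuum statement, NOT a Yang–Mills mass-gap claim.  No sharpness claimed (Haar truth `8/3`;
the cell's two-engine FLOAT value at `B = −(3/5)·1` is `E₁ = 1.80`, here `K₃ = 0.55`).

THE MECHANISM.  In the tree's frame calculus the one-link Hessian term of Bochner's formula is `H = ∑ D_αu D_βu D_αD_βS = c Re tr(Q Z² B)`,
`Z = ∇u(Q) ∈ 𝔰𝔲(3)`, `S = c Re tr(QB)` (`sum_sum_hess_potential`).  Bakry–Émery bounds `|H| ≤ |c|‖B‖_op Γ(u,u)` (`Γ(u,u) = ‖Z‖_F²`), whence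
`Γ₂ ≥ (3/2 − 3‖B‖_op)Γ` and the Poincaré constant `1/(3(1/2 − R))`, capped at `R < 1/2`.  Split `Z² = −(‖Z‖²/3)·1 + Z²₀`: the isotropic
third contributes `−(S/3)Γ(u,u)` — a multiple of the WEIGHT ITSELF, which integrates against `e^S` exactly like the sphere term of J-SC13
and CANCELS under the twist `θ = 2/(n+2) = 1/5` (`n = dim 𝔰𝔲(3) = 8`, `ΔS = −(8/3)S`, `TwistedBochnerSUN.twisted_bochner`); the traceless
part `Z²₀` has `‖Z²₀‖_F² = ‖Z‖⁴/6` on `𝔰𝔲(3)` (Cayley–Hamilton `tr Z⁴ = ½(tr Z²)²` for traceless `3 × 3`), so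
`|c Re tr(Q Z²₀ B)| ≤ |c|‖B‖_F Γ(u,u)/√6` (`hess_pot_le_su3`).  Integrating (`∫e^S(L_S u)² = ∫e^SΓ₂`, `∫e^SΓ(S,Γ(u,u)) = ∫e^S((8/3)S − Γ(S,S))Γ`,
`∫e^S (L_S u)Γ(S,u) = −∫e^S Γ(Γ(S,u),u)`):
* `integral_exp_mul_Gam_le_twisted_su3`: `(12/7 − (32/35)|c|‖B‖_F/√6) ∫e^S Γ(u,u) ≤ ∫e^S (L_S u)²` for EVERY `c`, `B`, smooth `u`;
* `su3_var_tilted_le_twisted`: `Var_{ν_B}(ψ) ≤ M²/K` for `M`-Lipschitz `ψ` and every `0 < K ≤ 12/7 − (96/35)‖B‖_F/√6` (J-SC12's generic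
  `poincare_pot_K` / `var_tilted_le_of_poincare_K`);
* `oneLinkPoincareSUN_su3_twisted`: `OneLinkPoincareSUN 3 R (1/K)` whenever `0 < K` and `K + (97/50)R ≤ 12/7` (`‖B‖_F ≤ √3‖B‖_op`,
  `(96/35)/√2 = 1.9395 ≤ 97/50`); radius cap `R < 600/679 ≈ 0.88` against Bakry–Émery's `1/2`.
WHAT IT BUYS (FLOAT, `1/K₃(R)` vs `1/(3(1/2−R))`): `R = 1/5`: `0.75` vs `1.11`; `1/4`: `0.81` vs `1.33`; `3/10`: `0.88` vs `1.67`; `11/30`: `1.00`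
vs `2.5`; `2/5`: `1.07` vs `3.33` — every hypothesis-free `SU(3)` modulus `√(c·v)` of the tree shrinks by `√(3(1/2−R)/K₃(R))` (row files follow).
NOT CLAIMED: anything for `N ≥ 4` (in the worst case the isotropic part of `Z²` is too small: no gain over Bakry–Émery by this split), `SU(2)`
(J-SC13 is sharp there), the CERTIFIED (H1 ∧ H2) column, sharpness.

References: Bakry–Émery LNM 1123 (1985); Bakry–Gentil–Ledoux, Grundlehren 348 (2014) §1.16, C.6; Shen–Zhu–Zhu CMP 400 (2023) Lemma 4.1,
(4.7)–(4.8); the tree's J-SC12/J-SC13 (`StrongCouplingDimensionalPoincare/Window`, `StrongCouplingSharpTwist/Curvature`); cell note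
`HOME/pub-ymgap-engine-2/TWISTED-BOCHNER-SU3.md`.
-/

noncomputable section

open scoped Matrix ComplexConjugate BigOperators Matrix.Norms.Frobenius ContDiff Topology
open Matrix Complex Finset MeasureTheory ProbabilityTheory
open Literature.MathematicalPhysics.QuantumFieldTheory
open Literature.MathematicalPhysics.QuantumFieldTheory.SUNBakryEmery
open Summit.QuantumFields.BalabanUV.InfraRed.StrongCouplingSharpTwist (Gam_Gam_left_eq)
open Summit.QuantumFields.BalabanUV.InfraRed.StrongCouplingDimensionalPoincare (poincare_pot_K)
open Summit.QuantumFields.BalabanUV.InfraRed.StrongCouplingDimensionalVariance (var_tilted_le_of_poincare_K)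
open Summit.QuantumFields.BalabanUV.InfraRed.StrongCouplingPoincareDoorSUN (OneLinkPoincareSUN)
open Summit.Ventures.YMGap.OneLinkEigen (Lap_pot frobNorm_le_sqrt_mul_matrixOpNorm)

namespace Summit.Ventures.YMGap.TwistedBochner

/-! ### 1. `𝔰𝔲(3)` algebra: `tr Z⁴ = ½(tr Z²)²` and `‖Z² + (‖Z‖²/3)·1‖_F² = ‖Z‖⁴/6` -/

/-- **Cayley–Hamilton for traceless `3 × 3` matrices**: `tr(Z⁴) = ½ (tr Z²)²` (Newton's identities with `e₁ = 0`). [folklore] -/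
theorem trace_sq_sq_fin_three (Z : Matrix (Fin 3) (Fin 3) ℂ) (h : Z.trace = 0) :
    (Z * Z * (Z * Z)).trace = (1 / 2) * (Z * Z).trace ^ 2 := by
  have h22 : Z 2 2 = -Z 0 0 - Z 1 1 := by
    rw [Matrix.trace_fin_three] at h
    linear_combination h
  simp only [Matrix.trace_fin_three, Matrix.mul_apply, Fin.sum_univ_three]
  rw [h22]
  ring

/-- **The traceless square of an element of `𝔰𝔲(3)`**: for `Zᴴ = −Z`, `tr Z = 0`, `‖Z·Z + (‖Z‖_F²/3)·1‖_F² = ‖Z‖_F⁴/6`. [folklore] -/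
theorem frobNorm_sq_tracelessSq_su3 {Z : Matrix (Fin 3) (Fin 3) ℂ} (hZ : Zᴴ = -Z) (hZ0 : Z.trace = 0) :
    frobNorm (Z * Z + ((frobNorm Z ^ 2 / 3 : ℝ) : ℂ) • (1 : Matrix (Fin 3) (Fin 3) ℂ)) ^ 2 = (frobNorm Z ^ 2) ^ 2 / 6 := by
  set s : ℝ := frobNorm Z ^ 2 with hs
  have hZZ : (Z * Z).trace = -(s : ℂ) := by
    rw [trace_mul_eq_re_of_skew hZ hZ, hs, frobNorm_sq_of_skew hZ]
    push_cast
    ring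
  have h4 : (Z * Z * (Z * Z)).trace = (1 / 2) * (s : ℂ) ^ 2 := by
    rw [trace_sq_sq_fin_three Z hZ0, hZZ]
    ring
  have hP : (Z * Z + ((s / 3 : ℝ) : ℂ) • (1 : Matrix (Fin 3) (Fin 3) ℂ))ᴴ = Z * Z + ((s / 3 : ℝ) : ℂ) • 1 := by
    rw [conjTranspose_add, conjTranspose_mul, hZ, neg_mul_neg, conjTranspose_smul, conjTranspose_one, Complex.star_def,
      Complex.conj_ofReal]
  rw [frobNorm_sq_eq_re_trace, hP]
  have hexp : (Z * Z + ((s / 3 : ℝ) : ℂ) • (1 : Matrix (Fin 3) (Fin 3) ℂ)) * (Z * Z + ((s / 3 : ℝ) : ℂ) • 1) =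
      Z * Z * (Z * Z) + (2 * ((s / 3 : ℝ) : ℂ)) • (Z * Z) + (((s / 3 : ℝ) : ℂ) * ((s / 3 : ℝ) : ℂ)) • (1 : Matrix (Fin 3) (Fin 3) ℂ) := by
    rw [Matrix.mul_add, Matrix.add_mul, Matrix.add_mul, Matrix.mul_smul, Matrix.smul_mul, Matrix.smul_mul, Matrix.mul_one,
      Matrix.one_mul, Matrix.mul_smul, Matrix.mul_one, smul_smul, two_mul, add_smul]
    abel
  rw [hexp, trace_add, trace_add, trace_smul, trace_smul, trace_one, h4, hZZ, Fintype.card_fin, smul_eq_mul, smul_eq_mul]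
  have e : (1 / 2 : ℂ) * (s : ℂ) ^ 2 + 2 * ((s / 3 : ℝ) : ℂ) * -(s : ℂ) + ((s / 3 : ℝ) : ℂ) * ((s / 3 : ℝ) : ℂ) * ((3 : ℕ) : ℂ) =
      ((s ^ 2 / 6 : ℝ) : ℂ) := by
    push_cast
    ring
  rw [e, Complex.ofReal_re]

/-! ### 2. The Hessian term of the one-link weight on `SU(3)`: isotropic third plus a traceless remainder -/

/-- **Hessian split on `SU(3)`**: for `S = c Re tr(·B)`, smooth `u`, `g ∈ SU(3)`, with `Γ = Γ(u,u)(g)`: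
`∑ D_αu D_βu D_αD_βS (g) ≤ −(1/3)·S(g)·Γ + |c|‖B‖_F Γ/√6` — the isotropic third of `Z² = −(Γ/3)·1 + Z²₀` is exact, the traceless
part is Cauchy–Schwarz `|Re tr(Z²₀ (B g))| ≤ ‖Z²₀‖_F‖B‖_F` with `‖Z²₀‖_F = Γ/√6`. [folklore] -/
theorem hess_pot_le_su3 (c : ℝ) (B : Matrix (Fin 3) (Fin 3) ℂ) (u : Matrix (Fin 3) (Fin 3) ℂ → ℝ) (g : SUN 3) :
    ∑ α, ∑ β, matD (frame α) u (g : Matrix (Fin 3) (Fin 3) ℂ) * matD (frame β) u (g : Matrix (Fin 3) (Fin 3) ℂ) *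
        matD (frame α) (matD (frame β) (pot c B)) (g : Matrix (Fin 3) (Fin 3) ℂ) ≤
      -(1 / 3) * (pot c B (g : Matrix (Fin 3) (Fin 3) ℂ) * Gam u u (g : Matrix (Fin 3) (Fin 3) ℂ)) +
        |c| * frobNorm B / Real.sqrt 6 * Gam u u (g : Matrix (Fin 3) (Fin 3) ℂ) := by
  have h3 : (3 : ℕ) ≠ 0 := by norm_num
  have hQ := SUN.mem_unitaryGroup g
  set Q : Matrix (Fin 3) (Fin 3) ℂ := (g : Matrix (Fin 3) (Fin 3) ℂ) with hQdef
  set Z : Matrix (Fin 3) (Fin 3) ℂ := frameGrad (dirFun u Q) with hZdef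
  have hZ : Zᴴ = -Z := frameGrad_conjTranspose _
  have hZ0 : Z.trace = 0 := frameGrad_trace h3 _
  have hΓ : Gam u u Q = frobNorm Z ^ 2 := Gam_self_eq_frobNorm_sq h3 u Q
  set s : ℝ := frobNorm Z ^ 2 with hs
  have hs0 : 0 ≤ s := sq_nonneg _
  have hH : ∑ α, ∑ β, matD (frame α) u Q * matD (frame β) u Q * matD (frame α) (matD (frame β) (pot c B)) Q =
      c * (Q * Z * Z * B).trace.re := sum_sum_hess_potential c B u Q
  set P : Matrix (Fin 3) (Fin 3) ℂ := Z * Z + ((s / 3 : ℝ) : ℂ) • (1 : Matrix (Fin 3) (Fin 3) ℂ) with hPdef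
  -- `‖P‖_F = s/√6`
  have hPn : frobNorm P = s / Real.sqrt 6 := by
    have h := frobNorm_sq_tracelessSq_su3 hZ hZ0
    rw [← hs, ← hPdef] at h
    have h6 : (0 : ℝ) < Real.sqrt 6 := Real.sqrt_pos.2 (by norm_num)
    have e : (s / Real.sqrt 6) ^ 2 = s ^ 2 / 6 := by
      rw [div_pow, Real.sq_sqrt (by norm_num : (0 : ℝ) ≤ 6)]
    rw [← e] at h
    exact (sq_eq_sq₀ (frobNorm_nonneg P) (div_nonneg hs0 h6.le)).1 h
  -- the split of the Hessian word
  have hsplit : (Q * Z * Z * B).trace.re = (P * (B * Q)).trace.re - s / 3 * (Q * B).trace.re := by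
    have e1 : Q * Z * Z * B = Q * P * B - ((s / 3 : ℝ) : ℂ) • (Q * B) := by
      rw [hPdef, Matrix.mul_add, Matrix.add_mul, Matrix.mul_smul, Matrix.mul_one, Matrix.smul_mul, Matrix.mul_assoc Q Z Z]
      abel
    have e2 : (Q * P * B).trace = (P * (B * Q)).trace := by
      rw [Matrix.mul_assoc, trace_mul_comm, Matrix.mul_assoc]
    rw [e1, trace_sub, trace_smul, e2, Complex.sub_re, smul_eq_mul, Complex.re_ofReal_mul]
  -- Cauchy–Schwarz on the traceless part
  have hb : |(P * (B * Q)).trace.re| ≤ s / Real.sqrt 6 * frobNorm B := by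
    calc |(P * (B * Q)).trace.re| ≤ frobNorm P * frobNorm (B * Q) := abs_re_trace_mul_le _ _
      _ = s / Real.sqrt 6 * frobNorm B := by rw [hPn, frobNorm_mul_unitary B hQ]
  have hb' : c * (P * (B * Q)).trace.re ≤ |c| * frobNorm B / Real.sqrt 6 * s := by
    calc c * (P * (B * Q)).trace.re ≤ |c * (P * (B * Q)).trace.re| := le_abs_self _
      _ = |c| * |(P * (B * Q)).trace.re| := abs_mul _ _
      _ ≤ |c| * (s / Real.sqrt 6 * frobNorm B) := mul_le_mul_of_nonneg_left hb (abs_nonneg c)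
      _ = |c| * frobNorm B / Real.sqrt 6 * s := by ring
  rw [hH, hsplit, hΓ]
  show c * ((P * (B * Q)).trace.re - s / 3 * (Q * B).trace.re) ≤ -(1 / 3) * (c * (Q * B).trace.re * s) + |c| * frobNorm B / Real.sqrt 6 * s
  nlinarith [hb']

/-! ### 3. The integrated twisted Bochner inequality on `SU(3)` -/

/-- `L_S S = −(8/3) S + Γ(S,S)` for the one-link weight on `SU(3)` (Casimir `3 − 1/3`). [folklore] -/
theorem genL_pot_self_three (c : ℝ) (B Q : Matrix (Fin 3) (Fin 3) ℂ) :
    genL (pot c B) (pot c B) Q = -(8 / 3) * pot c B Q + Gam (pot c B) (pot c B) Q := by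
  show Lap (pot c B) Q + Gam (pot c B) (pot c B) Q = _
  rw [Lap_pot (by norm_num : (3 : ℕ) ≠ 0) c B]
  norm_num

/-- **THE INTEGRATED TWISTED BOCHNER INEQUALITY ON `SU(3)`**: for `S = pot c B = c Re tr(·B)` with ANY `c ∈ ℝ`, `B ∈ M₃(ℂ)` and every
smooth `u`, `(12/7 − (32/35)·|c|‖B‖_F/√6) ∫ e^S Γ(u,u) dσ ≤ ∫ e^S (L_S u)² dσ`.  Proof: the pointwise `twisted_bochner` at `N = 3`,
`θ = 1/5` plus `(4/5)×hess_pot_le_su3`, integrated against `e^S dσ`; the tree's integrations by parts `∫e^S(L_S u)² = ∫e^SΓ₂`,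
`∫e^S Γ(S,Γ(u,u)) = (8/3)∫e^S SΓ − ∫e^S Γ(S,S)Γ`, `∫e^S (L_S u)Γ(S,u) = −∫e^S Γ(Γ(S,u),u)`; every `SΓ` term cancels. [folklore] -/
theorem integral_exp_mul_Gam_le_twisted_su3 (c : ℝ) (B : Matrix (Fin 3) (Fin 3) ℂ) {u : Matrix (Fin 3) (Fin 3) ℂ → ℝ}
    (hu : ContDiff ℝ ∞ u) :
    (12 / 7 - 32 / 35 * (|c| * frobNorm B / Real.sqrt 6)) * ∫ g : SUN 3, Real.exp (pot c B g) * Gam u u g ∂(haarSU 3) ≤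
      ∫ g : SUN 3, Real.exp (pot c B g) * genL (pot c B) u g ^ 2 ∂(haarSU 3) := by
  have h3 : (3 : ℕ) ≠ 0 := by norm_num
  have hS : ContDiff ℝ ∞ (pot (N := 3) c B) := contDiff_pot c B
  set κ : ℝ := |c| * frobNorm B / Real.sqrt 6 with hκ
  -- integrability of the atoms
  have hwint : ∀ {f : Matrix (Fin 3) (Fin 3) ℂ → ℝ}, ContDiff ℝ ∞ f →
      Integrable (fun g : SUN 3 => Real.exp (pot c B g) * f g) (haarSU 3) :=
    fun hf => integrable_of_continuous_SUN (continuous_restrict (hS.exp.mul hf)) _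
  have hG2c : ContDiff ℝ ∞ (Gam2 (pot (N := 3) c B) u) := by
    have e : Gam2 (pot (N := 3) c B) u = fun Q => (1 / 2) * genL (pot c B) (Gam u u) Q - Gam u (genL (pot c B) u) Q := rfl
    rw [e]
    exact (contDiff_const.mul (contDiff_genL hS (contDiff_Gam hu hu))).sub (contDiff_Gam hu (contDiff_genL hS hu))
  have iA : Integrable (fun g : SUN 3 => Real.exp (pot c B g) * genL (pot c B) u g ^ 2) (haarSU 3) :=
    hwint (f := fun Q => genL (pot c B) u Q ^ 2) ((contDiff_genL hS hu).pow 2)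
  have iΓ : Integrable (fun g : SUN 3 => Real.exp (pot c B g) * Gam u u g) (haarSU 3) := hwint (contDiff_Gam hu hu)
  have iP : Integrable (fun g : SUN 3 => Real.exp (pot c B g) * (pot c B g * Gam u u g)) (haarSU 3) :=
    hwint (f := fun Q => pot c B Q * Gam u u Q) (hS.mul (contDiff_Gam hu hu))
  have iW : Integrable (fun g : SUN 3 => Real.exp (pot c B g) * (Gam (pot c B) (pot c B) g * Gam u u g)) (haarSU 3) :=
    hwint (f := fun Q => Gam (pot c B) (pot c B) Q * Gam u u Q) ((contDiff_Gam hS hS).mul (contDiff_Gam hu hu))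
  have iG2 : Integrable (fun g : SUN 3 => Real.exp (pot c B g) * Gam2 (pot c B) u g) (haarSU 3) := hwint hG2c
  have iX : Integrable (fun g : SUN 3 => Real.exp (pot c B g) * Gam (pot c B) (Gam u u) g) (haarSU 3) :=
    hwint (contDiff_Gam hS (contDiff_Gam hu hu))
  have iLG : Integrable (fun g : SUN 3 => Real.exp (pot c B g) * (genL (pot c B) u g * Gam (pot c B) u g)) (haarSU 3) :=
    hwint (f := fun Q => genL (pot c B) u Q * Gam (pot c B) u Q) ((contDiff_genL hS hu).mul (contDiff_Gam hS hu))
  have iHg : Integrable (fun g : SUN 3 => Real.exp (pot c B g) * Gam (Gam (pot c B) u) u g) (haarSU 3) :=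
    hwint (contDiff_Gam (contDiff_Gam hS hu) hu)
  -- (0) the integrated Bochner formula
  have h0 : ∫ g : SUN 3, Real.exp (pot c B g) * genL (pot c B) u g ^ 2 ∂(haarSU 3) =
      ∫ g : SUN 3, Real.exp (pot c B g) * Gam2 (pot c B) u g ∂(haarSU 3) :=
    integral_exp_mul_genL_sq h3 hS hu
  -- (1) `∫ e^S Γ(S,Γ(u,u)) = (8/3) ∫ e^S S Γ(u,u) - ∫ e^S Γ(S,S) Γ(u,u)`
  have h1 : ∫ g : SUN 3, Real.exp (pot c B g) * Gam (pot c B) (Gam u u) g ∂(haarSU 3) =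
      (8 / 3) * ∫ g : SUN 3, Real.exp (pot c B g) * (pot c B g * Gam u u g) ∂(haarSU 3) -
        ∫ g : SUN 3, Real.exp (pot c B g) * (Gam (pot c B) (pot c B) g * Gam u u g) ∂(haarSU 3) := by
    have h := integral_mul_exp_mul_genL h3 hS (contDiff_Gam hu hu) hS
    have e : ∀ g : SUN 3, Gam u u g * (Real.exp (pot c B g) * genL (pot c B) (pot c B) g) =
        -((8 / 3) * (Real.exp (pot c B g) * (pot c B g * Gam u u g))) +
          Real.exp (pot c B g) * (Gam (pot c B) (pot c B) g * Gam u u g) := by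
      intro g
      rw [genL_pot_self_three]
      ring
    have e' : ∀ g : SUN 3, Real.exp (pot c B g) * Gam (Gam u u) (pot c B) g =
        Real.exp (pot c B g) * Gam (pot c B) (Gam u u) g := by
      intro g
      rw [Gam_comm (Gam u u) (pot c B)]
    simp_rw [e, e'] at h
    have iPn : Integrable (fun g : SUN 3 => -((8 / 3) * (Real.exp (pot c B g) * (pot c B g * Gam u u g)))) (haarSU 3) :=
      (iP.const_mul (8 / 3)).neg
    rw [integral_add iPn iW, integral_neg, integral_const_mul] at h
    linarith
  -- (2) `∫ e^S (L_S u) Γ(S,u) = -∫ e^S Γ(Γ(S,u),u)`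
  have h2 : ∫ g : SUN 3, Real.exp (pot c B g) * (genL (pot c B) u g * Gam (pot c B) u g) ∂(haarSU 3) =
      -∫ g : SUN 3, Real.exp (pot c B g) * Gam (Gam (pot c B) u) u g ∂(haarSU 3) := by
    have h := integral_mul_exp_mul_genL h3 hS (contDiff_Gam hS hu) hu
    have e : ∀ g : SUN 3, Gam (pot c B) u g * (Real.exp (pot c B g) * genL (pot c B) u g) =
        Real.exp (pot c B g) * (genL (pot c B) u g * Gam (pot c B) u g) := fun g => by ring
    simp_rw [e] at h
    exact h
  -- (3) the pointwise twisted inequality plus `(4/5)×` the Hessian split, integrated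
  have h3' : (3 / 2 - 4 / 5 * κ) * ∫ g : SUN 3, Real.exp (pot c B g) * Gam u u g ∂(haarSU 3) ≤
      (1 / 5) * ∫ g : SUN 3, Real.exp (pot c B g) * (genL (pot c B) u g * Gam (pot c B) u g) ∂(haarSU 3) +
        (1 / 50) * ∫ g : SUN 3, Real.exp (pot c B g) * (Gam (pot c B) (pot c B) g * Gam u u g) ∂(haarSU 3) +
        (1 / 5) * ∫ g : SUN 3, Real.exp (pot c B g) * Gam (Gam (pot c B) u) u g ∂(haarSU 3) +
        (1 / 10) * ∫ g : SUN 3, Real.exp (pot c B g) * Gam (pot c B) (Gam u u) g ∂(haarSU 3) -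
        (4 / 15) * ∫ g : SUN 3, Real.exp (pot c B g) * (pot c B g * Gam u u g) ∂(haarSU 3) -
        (1 / 8) * ∫ g : SUN 3, Real.exp (pot c B g) * genL (pot c B) u g ^ 2 ∂(haarSU 3) +
        ∫ g : SUN 3, Real.exp (pot c B g) * Gam2 (pot c B) u g ∂(haarSU 3) := by
    have hpt : ∀ g : SUN 3, (3 / 2 - 4 / 5 * κ) * (Real.exp (pot c B g) * Gam u u g) ≤
        (1 / 5) * (Real.exp (pot c B g) * (genL (pot c B) u g * Gam (pot c B) u g)) +
          (1 / 50) * (Real.exp (pot c B g) * (Gam (pot c B) (pot c B) g * Gam u u g)) +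
          (1 / 5) * (Real.exp (pot c B g) * Gam (Gam (pot c B) u) u g) +
          (1 / 10) * (Real.exp (pot c B g) * Gam (pot c B) (Gam u u) g) -
          (4 / 15) * (Real.exp (pot c B g) * (pot c B g * Gam u u g)) -
          (1 / 8) * (Real.exp (pot c B g) * genL (pot c B) u g ^ 2) +
          Real.exp (pot c B g) * Gam2 (pot c B) u g := by
      intro g
      have hT := twisted_bochner h3 hS hu (1 / 5) (g : Matrix (Fin 3) (Fin 3) ℂ)
      have hE := hess_pot_le_su3 c B u g
      have hL := Gam_Gam_left_eq h3 hS hu (g : Matrix (Fin 3) (Fin 3) ℂ)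
      have hw : 0 < Real.exp (pot c B g) := Real.exp_pos _
      have hsq : 0 ≤ Gam (pot c B) u (g : Matrix (Fin 3) (Fin 3) ℂ) ^ 2 := sq_nonneg _
      -- pointwise combination, then multiply by the weight
      have hcomb : (3 / 2 - 4 / 5 * κ) * Gam u u (g : Matrix (Fin 3) (Fin 3) ℂ) ≤
          (1 / 5) * (genL (pot c B) u g * Gam (pot c B) u g) +
            (1 / 50) * (Gam (pot c B) (pot c B) g * Gam u u g) +
            (1 / 5) * Gam (Gam (pot c B) u) u g + (1 / 10) * Gam (pot c B) (Gam u u) g -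
            (4 / 15) * (pot c B g * Gam u u g) - (1 / 8) * genL (pot c B) u g ^ 2 + Gam2 (pot c B) u g := by
        rw [hκ]
        simp only [Nat.cast_ofNat] at hT
        nlinarith [hT, hE, hL, hsq]
      have := mul_le_mul_of_nonneg_left hcomb hw.le
      nlinarith [this]
    have iS1 : Integrable (fun g : SUN 3 =>
        (1 / 5) * (Real.exp (pot c B g) * (genL (pot c B) u g * Gam (pot c B) u g)) +
          (1 / 50) * (Real.exp (pot c B g) * (Gam (pot c B) (pot c B) g * Gam u u g))) (haarSU 3) :=
      (iLG.const_mul (1 / 5)).add (iW.const_mul (1 / 50))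
    have iS2 : Integrable (fun g : SUN 3 =>
        (1 / 5) * (Real.exp (pot c B g) * (genL (pot c B) u g * Gam (pot c B) u g)) +
          (1 / 50) * (Real.exp (pot c B g) * (Gam (pot c B) (pot c B) g * Gam u u g)) +
          (1 / 5) * (Real.exp (pot c B g) * Gam (Gam (pot c B) u) u g)) (haarSU 3) :=
      iS1.add (iHg.const_mul (1 / 5))
    have iS3 : Integrable (fun g : SUN 3 =>
        (1 / 5) * (Real.exp (pot c B g) * (genL (pot c B) u g * Gam (pot c B) u g)) +
          (1 / 50) * (Real.exp (pot c B g) * (Gam (pot c B) (pot c B) g * Gam u u g)) +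
          (1 / 5) * (Real.exp (pot c B g) * Gam (Gam (pot c B) u) u g) +
          (1 / 10) * (Real.exp (pot c B g) * Gam (pot c B) (Gam u u) g)) (haarSU 3) :=
      iS2.add (iX.const_mul (1 / 10))
    have iS4 : Integrable (fun g : SUN 3 =>
        (1 / 5) * (Real.exp (pot c B g) * (genL (pot c B) u g * Gam (pot c B) u g)) +
          (1 / 50) * (Real.exp (pot c B g) * (Gam (pot c B) (pot c B) g * Gam u u g)) +
          (1 / 5) * (Real.exp (pot c B g) * Gam (Gam (pot c B) u) u g) +
          (1 / 10) * (Real.exp (pot c B g) * Gam (pot c B) (Gam u u) g) -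
          (4 / 15) * (Real.exp (pot c B g) * (pot c B g * Gam u u g))) (haarSU 3) :=
      iS3.sub (iP.const_mul (4 / 15))
    have iS5 : Integrable (fun g : SUN 3 =>
        (1 / 5) * (Real.exp (pot c B g) * (genL (pot c B) u g * Gam (pot c B) u g)) +
          (1 / 50) * (Real.exp (pot c B g) * (Gam (pot c B) (pot c B) g * Gam u u g)) +
          (1 / 5) * (Real.exp (pot c B g) * Gam (Gam (pot c B) u) u g) +
          (1 / 10) * (Real.exp (pot c B g) * Gam (pot c B) (Gam u u) g) -
          (4 / 15) * (Real.exp (pot c B g) * (pot c B g * Gam u u g)) -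
          (1 / 8) * (Real.exp (pot c B g) * genL (pot c B) u g ^ 2)) (haarSU 3) :=
      iS4.sub (iA.const_mul (1 / 8))
    have iS6 : Integrable (fun g : SUN 3 =>
        (1 / 5) * (Real.exp (pot c B g) * (genL (pot c B) u g * Gam (pot c B) u g)) +
          (1 / 50) * (Real.exp (pot c B g) * (Gam (pot c B) (pot c B) g * Gam u u g)) +
          (1 / 5) * (Real.exp (pot c B g) * Gam (Gam (pot c B) u) u g) +
          (1 / 10) * (Real.exp (pot c B g) * Gam (pot c B) (Gam u u) g) -
          (4 / 15) * (Real.exp (pot c B g) * (pot c B g * Gam u u g)) -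
          (1 / 8) * (Real.exp (pot c B g) * genL (pot c B) u g ^ 2) +
          Real.exp (pot c B g) * Gam2 (pot c B) u g) (haarSU 3) :=
      iS5.add iG2
    have iL : Integrable (fun g : SUN 3 => (3 / 2 - 4 / 5 * κ) * (Real.exp (pot c B g) * Gam u u g)) (haarSU 3) :=
      iΓ.const_mul _
    have hm := integral_mono iL iS6 hpt
    rw [integral_add iS5 iG2, integral_sub iS4 (iA.const_mul (1 / 8)), integral_sub iS3 (iP.const_mul (4 / 15)),
      integral_add iS2 (iX.const_mul (1 / 10)), integral_add iS1 (iHg.const_mul (1 / 5)),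
      integral_add (iLG.const_mul (1 / 5)) (iW.const_mul (1 / 50)),
      integral_const_mul, integral_const_mul, integral_const_mul, integral_const_mul, integral_const_mul,
      integral_const_mul, integral_const_mul] at hm
    exact hm
  have hW0 : 0 ≤ ∫ g : SUN 3, Real.exp (pot c B g) * (Gam (pot c B) (pot c B) g * Gam u u g) ∂(haarSU 3) :=
    integral_nonneg fun g => mul_nonneg (Real.exp_pos _).le (mul_nonneg (Gam_self_nonneg _ _) (Gam_self_nonneg _ _))
  rw [hκ] at h3'
  nlinarith [h0, h1, h2, h3', hW0]

/-! ### 4. The Poincaré constant of the one-link law on `SU(3)` -/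

/-- **The twisted one-link variance bound on `SU(3)`** (hypothesis-free): for `B ∈ M₃(ℂ)`, every `0 < K` with
`K ≤ 12/7 − (96/35)‖B‖_F/√6`, and every `ψ` with `|ψ(a) − ψ(b)| ≤ M‖a − b‖_F`:  `Var_{ν_B}(ψ) ≤ M²/K`,
`ν_B(dg) ∝ exp(3 Re tr(gB)) dg` (the integrated inequality fed into J-SC12's `poincare_pot_K` and `var_tilted_le_of_poincare_K`). [folklore] -/
theorem su3_var_tilted_le_twisted (B : Matrix (Fin 3) (Fin 3) ℂ) {K : ℝ} (hK : 0 < K)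
    (hKle : K ≤ 12 / 7 - 96 / 35 * (frobNorm B / Real.sqrt 6))
    (ψ : Matrix.specialUnitaryGroup (Fin 3) ℂ → ℝ) (M : ℝ) (hM : 0 ≤ M)
    (hψ : ∀ a b, |ψ a - ψ b| ≤ M * suFrobDist a b) :
    Var[ψ; (haarProbability (Matrix.specialUnitaryGroup (Fin 3) ℂ)).tilted
        fun g => ((3 : ℕ) : ℝ) * ((g : Matrix (Fin 3) (Fin 3) ℂ) * B).trace.re] ≤ M ^ 2 / K := by
  have h3 : (3 : ℕ) ≠ 0 := by norm_num
  have hc : |((3 : ℕ) : ℝ)| = 3 := by norm_num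
  have hGam : ∀ {v : Matrix (Fin 3) (Fin 3) ℂ → ℝ}, ContDiff ℝ ∞ v →
      K * ∫ g : SUN 3, Real.exp (pot ((3 : ℕ) : ℝ) B g) * Gam v v g ∂(haarSU 3) ≤
        ∫ g : SUN 3, Real.exp (pot ((3 : ℕ) : ℝ) B g) * genL (pot ((3 : ℕ) : ℝ) B) v g ^ 2 ∂(haarSU 3) := by
    intro v hv
    have h := integral_exp_mul_Gam_le_twisted_su3 ((3 : ℕ) : ℝ) B hv
    rw [hc] at h
    have hI : 0 ≤ ∫ g : SUN 3, Real.exp (pot ((3 : ℕ) : ℝ) B g) * Gam v v g ∂(haarSU 3) :=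
      integral_nonneg fun g => mul_nonneg (Real.exp_pos _).le (Gam_self_nonneg _ _)
    have hKle' : K ≤ 12 / 7 - 32 / 35 * (3 * frobNorm B / Real.sqrt 6) := by
      have : 32 / 35 * (3 * frobNorm B / Real.sqrt 6) = 96 / 35 * (frobNorm B / Real.sqrt 6) := by ring
      linarith
    exact (mul_le_mul_of_nonneg_right hKle' hI).trans h
  have hP : ∀ {F : Matrix (Fin 3) (Fin 3) ℂ → ℝ}, ContDiff ℝ ∞ F →
      K * ∫ g : SUN 3, Real.exp (pot ((3 : ℕ) : ℝ) B g) * (F g -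
          (∫ g : SUN 3, Real.exp (pot ((3 : ℕ) : ℝ) B g) * F g ∂(haarSU 3)) /
            (∫ g : SUN 3, Real.exp (pot ((3 : ℕ) : ℝ) B g) ∂(haarSU 3))) ^ 2 ∂(haarSU 3) ≤
        ∫ g : SUN 3, Real.exp (pot ((3 : ℕ) : ℝ) B g) * Gam F F g ∂(haarSU 3) :=
    fun hF => poincare_pot_K h3 ((3 : ℕ) : ℝ) B hK hGam hF
  exact var_tilted_le_of_poincare_K (N := 3) h3 B hK hP ψ M hM hψ

/-- `‖B‖_F/√6 ≤ (97/160)·‖B‖_op` on `M₃(ℂ)` (`‖B‖_F ≤ √3‖B‖_op`, `√3/√6 = 1/√2 ≤ 97·35/(96·50)`; kept rational for the rows: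
`(96/35)·(97·35/(96·50)) = 97/50`). [folklore] -/
theorem frobNorm_div_sqrt_six_le (B : Matrix (Fin 3) (Fin 3) ℂ) :
    96 / 35 * (frobNorm B / Real.sqrt 6) ≤ 97 / 50 * matrixOpNorm B := by
  have h6 : (0 : ℝ) < Real.sqrt 6 := Real.sqrt_pos.2 (by norm_num)
  have hF : frobNorm B ≤ Real.sqrt 3 * matrixOpNorm B := by
    have h := frobNorm_le_sqrt_mul_matrixOpNorm B
    norm_num at h
    exact h
  have hop : 0 ≤ matrixOpNorm B := matrixOpNorm_nonneg B
  -- `√3 ≤ (97/50)(35/96) √6`, i.e. `3 ≤ ((97·35)/(50·96))² · 6`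
  have hsq : Real.sqrt 3 ≤ (97 * 35) / (50 * 96) * Real.sqrt 6 := by
    rw [show (97 * 35 : ℝ) / (50 * 96) * Real.sqrt 6 = Real.sqrt (((97 * 35) / (50 * 96)) ^ 2 * 6) by
      rw [Real.sqrt_mul (sq_nonneg _), Real.sqrt_sq (by norm_num)]]
    exact Real.sqrt_le_sqrt (by norm_num)
  rw [mul_div_assoc', div_le_iff₀ h6]
  nlinarith [hF, hsq, hop, h6]

/-- **`OneLinkPoincareSUN 3 R (1/K)` — the twisted one-link Poincaré constant on `SU(3)`** (hypothesis-free): for every `0 < K` and `R`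
with `K + (97/50)·R ≤ 12/7` (so `R < 600/679 ≈ 0.88`; `97/50 ≥ 48√2/35 = 1.9395`), on the operator-norm ball `‖B‖_op ≤ R` every
`M`-Lipschitz `ψ` has `Var_{ν_B}(ψ) ≤ M²/K`.  Bakry–Émery (`oneLinkPoincareSUN_bakryEmery`): `1/(3(1/2 − R))`, `R < 1/2` only. [folklore] -/
theorem oneLinkPoincareSUN_su3_twisted {R K : ℝ} (hK : 0 < K) (hKR : K + 97 / 50 * R ≤ 12 / 7) :
    OneLinkPoincareSUN 3 R (1 / K) := by
  intro B hB ψ M hM hψ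
  have hKle : K ≤ 12 / 7 - 96 / 35 * (frobNorm B / Real.sqrt 6) := by
    have h := frobNorm_div_sqrt_six_le B
    nlinarith [h, hB]
  have h := su3_var_tilted_le_twisted B hK hKle ψ M hM hψ
  calc Var[ψ; (haarProbability (Matrix.specialUnitaryGroup (Fin 3) ℂ)).tilted
          fun g => ((3 : ℕ) : ℝ) * ((g : Matrix (Fin 3) (Fin 3) ℂ) * B).trace.re] ≤ M ^ 2 / K := h
    _ = 1 / K * M ^ 2 := by ring

/-- The twisted constant at the cell's star radius `R = 11/30` (`β_W = 11/20`, `d = 4`): `OneLinkPoincareSUN 3 (11/30) 1` (`K = 1`;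
Bakry–Émery gives `5/2`). [folklore] -/
theorem oneLinkPoincareSUN_su3_twisted_elevenThirtieths : OneLinkPoincareSUN 3 (11 / 30) 1 := by
  have h := oneLinkPoincareSUN_su3_twisted (R := 11 / 30) (K := 1) one_pos (by norm_num)
  rwa [div_one] at h

/-- The twisted constant at the Bakry–Émery cap `R = 1/2` (where Bakry–Émery gives nothing): `OneLinkPoincareSUN 3 (1/2) (100/74)`
(`K = 74/100 ≤ 12/7 − 97/100`). [folklore] -/
theorem oneLinkPoincareSUN_su3_twisted_half : OneLinkPoincareSUN 3 (1 / 2) (100 / 74) := by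
  have h := oneLinkPoincareSUN_su3_twisted (R := 1 / 2) (K := 74 / 100) (by norm_num) (by norm_num)
  norm_num at h ⊢
  exact h

end Summit.Ventures.YMGap.TwistedBochner

end
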